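import Mathlib
import Summits.Ventures.PercRepro2.EdgeSplit
import Summits.Ventures.PercRepro2.CondCovariance

/-!
# The status of one edge as a sub-σ-algebra: the edge split is the law of total covariance
(blind cell PercRepro2, typer-1 g18; a language line)

`EdgeSplit.lean` proved the edge split `cov[f, g; μ_p] = p e · cov[f, g; μ_{p[e↦1]}] +
(1 − p e) · cov[f, g; μ_{p[e↦0]}] + p e (1 − p e) (E_{p[e↦1]} f − E_{p[e↦0]} f)(E_{p[e↦1]} g − E_{p[e↦0]} g)`
by the pinning identity and `ring`.  This file identifies it with the general law of total
covariance of `CondCovariance.lean` for the two-atom σ-algebra `σ(status of e) =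
generateFrom {openEdge e}`:

* `edgeMean p e f = (E_{p[e↦1]} f on {e open}, E_{p[e↦0]} f on {e closed})` and
  **`condExp_generateFrom_openEdge`**: `μ_p[f | σ(status of e)] =ᵐ edgeMean p e f` for EVERY weight
  vector (a null atom costs nothing);
* `covariance_edgeMean`: the BETWEEN part, `cov[edgeMean f, edgeMean g; μ_p] =
  p e (1 − p e)(E_{p[e↦1]} f − E_{p[e↦0]} f)(E_{p[e↦1]} g − E_{p[e↦0]} g)`;
* `integral_condCovSigma_generateFrom_openEdge`: the WITHIN part,
  `μ_p[Cov(f, g | σ(status of e))] = p e · cov[f, g; μ_{p[e↦1]}] + (1 − p e) · cov[f, g; μ_{p[e↦0]}]`;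
* `covariance_eq_pin_of_total_covariance`: the edge split re-derived from
  `integral_condCovSigma_add_covariance_condExp` — the two proofs agree.

Identities only; nothing about the sign of any term.
-/

namespace Summit.Ventures.PercRepro2

open MeasureTheory ProbabilityTheory MeasureBridge

namespace EdgeSplit

section CondExp

variable {E : Type*} [Fintype E] [DecidableEq E]

omit [DecidableEq E] in
/-- The σ-algebra of the status of the edge `e` is coarser than the product σ-algebra. -/
lemma generateFrom_openEdge_le (e : E) :
    MeasurableSpace.generateFrom {openEdge e} ≤ (inferInstance : MeasurableSpace (Config E)) :=
  MeasurableSpace.generateFrom_singleton_le MeasurableSet.of_discrete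

omit [Fintype E] [DecidableEq E] in
/-- The σ-algebra generated by `{e closed}` is the one generated by `{e open}`. -/
lemma generateFrom_closedEdge (e : E) :
    MeasurableSpace.generateFrom {closedEdge e} = MeasurableSpace.generateFrom {openEdge e} := by
  rw [closedEdge_eq_compl]
  apply le_antisymm
  · refine MeasurableSpace.generateFrom_le fun t ht => ?_
    rw [Set.mem_singleton_iff] at ht
    subst ht
    exact (MeasurableSpace.measurableSet_generateFrom (Set.mem_singleton (openEdge e))).compl
  · refine MeasurableSpace.generateFrom_le fun t ht => ?_
    rw [Set.mem_singleton_iff] at ht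
    subst ht
    have h := (MeasurableSpace.measurableSet_generateFrom (Set.mem_singleton (openEdge e)ᶜ)).compl
    rwa [compl_compl] at h

/-- The two-point conditional mean of `f` given the status of `e`: `E_{p[e↦1]} f` on `{e open}`,
`E_{p[e↦0]} f` on `{e closed}`. -/
noncomputable def edgeMean (p : E → ℝ) (e : E) (f : Config E → ℝ) : Config E → ℝ :=
  fun ω => if ω e = true then expect (Function.update p e 1) f else expect (Function.update p e 0) f

/-- `edgeMean` on `{e open}`. -/
lemma edgeMean_of_eq_true (p : E → ℝ) (e : E) (f : Config E → ℝ) {ω : Config E} (h : ω e = true) :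
    edgeMean p e f ω = expect (Function.update p e 1) f := by
  simp [edgeMean, h]

/-- `edgeMean` on `{e closed}`. -/
lemma edgeMean_of_eq_false (p : E → ℝ) (e : E) (f : Config E → ℝ) {ω : Config E}
    (h : ω e = false) : edgeMean p e f ω = expect (Function.update p e 0) f := by
  simp [edgeMean, h]

/-- The expectation pinned open only sees the atom `{e open}`. -/
lemma expect_update_one_congr (p : E → ℝ) (e : E) {h h' : Config E → ℝ}
    (hh : ∀ ω : Config E, ω e = true → h ω = h' ω) :
    expect (Function.update p e 1) h = expect (Function.update p e 1) h' := by
  unfold expect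
  refine Finset.sum_congr rfl fun ω _ => ?_
  by_cases hω : ω e = true
  · rw [hh ω hω]
  · simp only [Bool.not_eq_true] at hω
    rw [weight_update_one_of_eq_false p hω, zero_mul, zero_mul]

/-- The expectation pinned closed only sees the atom `{e closed}`. -/
lemma expect_update_zero_congr (p : E → ℝ) (e : E) {h h' : Config E → ℝ}
    (hh : ∀ ω : Config E, ω e = false → h ω = h' ω) :
    expect (Function.update p e 0) h = expect (Function.update p e 0) h' := by
  unfold expect
  refine Finset.sum_congr rfl fun ω _ => ?_
  by_cases hω : ω e = true
  · rw [weight_update_zero_of_eq_true p hω, zero_mul, zero_mul]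
  · simp only [Bool.not_eq_true] at hω
    rw [hh ω hω]

/-- The centred product: `E_q[(f − E_q f)(g − E_q g)] = E_q[f g] − E_q f · E_q g`. -/
lemma expect_centered_mul (q : E → ℝ) (f g : Config E → ℝ) :
    expect q (fun ω => (f ω - expect q f) * (g ω - expect q g)) =
      expect q (fun ω => f ω * g ω) - expect q f * expect q g := by
  have h : (fun ω => (f ω - expect q f) * (g ω - expect q g)) =
      (fun ω => f ω * g ω) - (fun ω => expect q f * g ω) - (fun ω => expect q g * f ω)
        + fun _ => expect q f * expect q g := by
    funext ω
    simp only [Pi.add_apply, Pi.sub_apply]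
    ring
  rw [h, expect_add, expect_sub, expect_sub, expect_const_mul, expect_const_mul, expect_const]
  ring

/-- **The conditional expectation given the status of `e` is the two-point mean**:
`μ_p[f | σ(status of e)] =ᵐ edgeMean p e f`, for every weight vector. -/
theorem condExp_generateFrom_openEdge (p : E → ℝ) (hp : IsProbVec p) (e : E)
    (f : Config E → ℝ) :
    (percMeasureOf p hp)[f | MeasurableSpace.generateFrom {openEdge e}] =ᵐ[percMeasureOf p hp]
      edgeMean p e f := by
  apply ae_of_ae_restrict_of_ae_restrict_compl (openEdge e)
  · by_cases he : p e = 0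
    · have h0 : (percMeasureOf p hp).restrict (openEdge e) = 0 := by
        rw [Measure.restrict_eq_zero, ← measureReal_eq_zero_iff, percMeasureOf_real_apply,
          prob_openEdge]
        exact he
      rw [h0, ae_zero]
      exact Filter.eventually_bot
    · have h1 := condExp_generateFrom_singleton (μ := percMeasureOf p hp) (s := openEdge e)
        MeasurableSet.of_discrete (f := f) Integrable.of_finite
      filter_upwards [h1, ae_restrict_mem (μ := percMeasureOf p hp)
        (s := openEdge e) MeasurableSet.of_discrete] with ω hω hmem
      rw [hω, integral_cond_openEdge p hp he f, edgeMean_of_eq_true p e f hmem]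
  · rw [← closedEdge_eq_compl]
    by_cases he : p e = 1
    · have h0 : (percMeasureOf p hp).restrict (closedEdge e) = 0 := by
        rw [Measure.restrict_eq_zero, ← measureReal_eq_zero_iff, percMeasureOf_real_apply,
          prob_closedEdge, he, sub_self]
      rw [h0, ae_zero]
      exact Filter.eventually_bot
    · have h1 := condExp_generateFrom_singleton (μ := percMeasureOf p hp) (s := closedEdge e)
        MeasurableSet.of_discrete (f := f) Integrable.of_finite
      rw [generateFrom_closedEdge] at h1
      filter_upwards [h1, ae_restrict_mem (μ := percMeasureOf p hp)
        (s := closedEdge e) MeasurableSet.of_discrete] with ω hω hmem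
      rw [hω, integral_cond_closedEdge p hp he f, edgeMean_of_eq_false p e f hmem]

/-- The pinned expectation of a two-point mean is its value on the atom. -/
lemma expect_update_one_edgeMean (p : E → ℝ) (e : E) (f : Config E → ℝ) :
    expect (Function.update p e 1) (edgeMean p e f) = expect (Function.update p e 1) f := by
  have h := expect_update_one_congr p e (h := edgeMean p e f)
    (h' := fun _ => expect (Function.update p e 1) f) (fun ω hω => edgeMean_of_eq_true p e f hω)
  rw [h, expect_const]

/-- The pinned expectation of a two-point mean is its value on the atom. -/
lemma expect_update_zero_edgeMean (p : E → ℝ) (e : E) (f : Config E → ℝ) :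
    expect (Function.update p e 0) (edgeMean p e f) = expect (Function.update p e 0) f := by
  have h := expect_update_zero_congr p e (h := edgeMean p e f)
    (h' := fun _ => expect (Function.update p e 0) f) (fun ω hω => edgeMean_of_eq_false p e f hω)
  rw [h, expect_const]

/-- **The BETWEEN part**: the covariance of the two-point conditional means is
`p e (1 − p e)(E_{p[e↦1]} f − E_{p[e↦0]} f)(E_{p[e↦1]} g − E_{p[e↦0]} g)`. -/
theorem covariance_edgeMean (p : E → ℝ) (hp : IsProbVec p) (e : E) (f g : Config E → ℝ) :
    cov[edgeMean p e f, edgeMean p e g; percMeasureOf p hp] =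
      p e * (1 - p e) * (expect (Function.update p e 1) f - expect (Function.update p e 0) f)
        * (expect (Function.update p e 1) g - expect (Function.update p e 0) g) := by
  have h1 := expect_update_one_congr p e (h := fun ω => edgeMean p e f ω * edgeMean p e g ω)
    (h' := fun _ => expect (Function.update p e 1) f * expect (Function.update p e 1) g)
    (fun ω hω => by simp only [edgeMean_of_eq_true p e f hω, edgeMean_of_eq_true p e g hω])
  have h0 := expect_update_zero_congr p e (h := fun ω => edgeMean p e f ω * edgeMean p e g ω)
    (h' := fun _ => expect (Function.update p e 0) f * expect (Function.update p e 0) g)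
    (fun ω hω => by simp only [edgeMean_of_eq_false p e f hω, edgeMean_of_eq_false p e g hω])
  rw [covariance_percMeasureOf, expect_eq_pin p _ e, expect_eq_pin p (edgeMean p e f) e,
    expect_eq_pin p (edgeMean p e g) e, expect_update_one_edgeMean, expect_update_one_edgeMean,
    expect_update_zero_edgeMean, expect_update_zero_edgeMean, h1, h0, expect_const, expect_const]
  ring

/-- **The WITHIN part**: the mean conditional covariance given the status of `e` is the weighted
sum of the two pinned covariances. -/
theorem integral_condCovSigma_generateFrom_openEdge (p : E → ℝ) (hp : IsProbVec p) (e : E)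
    (f g : Config E → ℝ) :
    (∫ ω, CovForm.A3Means.condCovSigma (MeasurableSpace.generateFrom {openEdge e}) f g
        (percMeasureOf p hp) ω ∂(percMeasureOf p hp)) =
      p e * cov[f, g; percMeasureOf (Function.update p e 1) (hp.update e zero_le_one le_rfl)]
      + (1 - p e) * cov[f, g; percMeasureOf (Function.update p e 0)
          (hp.update e le_rfl zero_le_one)] := by
  unfold CovForm.A3Means.condCovSigma
  rw [integral_condExp (generateFrom_openEdge_le e)]
  have hcongr : (fun ω => (f ω - ((percMeasureOf p hp)[f | MeasurableSpace.generateFrom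
        {openEdge e}]) ω) * (g ω - ((percMeasureOf p hp)[g | MeasurableSpace.generateFrom
        {openEdge e}]) ω)) =ᵐ[percMeasureOf p hp]
      fun ω => (f ω - edgeMean p e f ω) * (g ω - edgeMean p e g ω) := by
    filter_upwards [condExp_generateFrom_openEdge p hp e f, condExp_generateFrom_openEdge p hp e g]
      with ω h1 h2
    rw [h1, h2]
  have h1 := expect_update_one_congr p e
    (h := fun ω => (f ω - edgeMean p e f ω) * (g ω - edgeMean p e g ω))
    (h' := fun ω => (f ω - expect (Function.update p e 1) f) * (g ω - expect (Function.update p e 1) g))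
    (fun ω hω => by simp only [edgeMean_of_eq_true p e f hω, edgeMean_of_eq_true p e g hω])
  have h0 := expect_update_zero_congr p e
    (h := fun ω => (f ω - edgeMean p e f ω) * (g ω - edgeMean p e g ω))
    (h' := fun ω => (f ω - expect (Function.update p e 0) f) * (g ω - expect (Function.update p e 0) g))
    (fun ω hω => by simp only [edgeMean_of_eq_false p e f hω, edgeMean_of_eq_false p e g hω])
  rw [integral_congr_ae hcongr, integral_percMeasureOf, expect_eq_pin p _ e, h1, h0,
    expect_centered_mul, expect_centered_mul, covariance_percMeasureOf, covariance_percMeasureOf]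

/-- **The edge split is the law of total covariance for `σ(status of e)`**: `covariance_eq_pin`
re-derived from `integral_condCovSigma_add_covariance_condExp` — the two proofs agree. -/
theorem covariance_eq_pin_of_total_covariance (p : E → ℝ) (hp : IsProbVec p) (e : E)
    (f g : Config E → ℝ) :
    cov[f, g; percMeasureOf p hp] =
      p e * cov[f, g; percMeasureOf (Function.update p e 1) (hp.update e zero_le_one le_rfl)]
      + (1 - p e) * cov[f, g; percMeasureOf (Function.update p e 0) (hp.update e le_rfl zero_le_one)]
      + p e * (1 - p e) * (expect (Function.update p e 1) f - expect (Function.update p e 0) f)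
          * (expect (Function.update p e 1) g - expect (Function.update p e 0) g) := by
  have htot := CovForm.A3Means.integral_condCovSigma_add_covariance_condExp
    (μ := percMeasureOf p hp) (generateFrom_openEdge_le e) (X := f) (Y := g)
    MemLp.of_discrete MemLp.of_discrete
  have hbtw : cov[(percMeasureOf p hp)[f | MeasurableSpace.generateFrom {openEdge e}],
      (percMeasureOf p hp)[g | MeasurableSpace.generateFrom {openEdge e}]; percMeasureOf p hp] =
      cov[edgeMean p e f, edgeMean p e g; percMeasureOf p hp] := by
    unfold covariance
    rw [integral_congr_ae (condExp_generateFrom_openEdge p hp e f),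
      integral_congr_ae (condExp_generateFrom_openEdge p hp e g)]
    refine integral_congr_ae ?_
    filter_upwards [condExp_generateFrom_openEdge p hp e f, condExp_generateFrom_openEdge p hp e g]
      with ω h1 h2
    rw [h1, h2]
  rw [← htot, integral_condCovSigma_generateFrom_openEdge, hbtw, covariance_edgeMean]

end CondExp

end EdgeSplit

end Summit.Ventures.PercRepro2
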